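import Mathlib
import Summits.NavierStokesRegularity.NavierStokesRegularity.Theorems.WakeRatchetAdmissibleEternalBoundFedSpike
import HarnessLib

/-!
# An UNFED shell of an admissible eternal solution vanishes; admissible eternal solutions have
# support unbounded below (support for `WakeRatchet.AdmissibleEternalBound`, stmt-NavierStokesRegularity-23197)

MODEL lattice ODEs only (Tao 2016 §4, §6.4); nothing in this file is a statement about the
Navier–Stokes equations, and no summit or rung is proved by it.

If shell `k-1` of an admissible eternal solution (`IsEternalVisc ε₀ ν̂ α W`, cancelling table, any
`ν̂ ≥ 0`) vanishes identically, shell `k` receives no feed; by the fed-spike fence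
(`WakeRatchetFedSpike.fedSpike` with zero source) `e^{b}‖W_k(b)‖ ≤ e^{C_A M/Λ} e^{a}‖W_k(a)‖` for all
`a ≤ b`, i.e. a non-zero value at `b` forces `‖W_k(a)‖ ≥ c e^{-a}` on the whole left half-line — not
integrable.  Hence:

* `eq_zero_of_unfed` — `W_{k-1} ≡ 0 ⟹ W_k ≡ 0`;
* `eq_zero_of_vanishing_below` — an admissible eternal solution vanishing on all shells below some
  level vanishes identically: NO non-trivial admissible eternal solution is supported on a half-lattice
  `{n ≥ n₀}` (every candidate counterexample / wave must come from `n = -∞`);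
* `exists_ne_zero_below` — contrapositive: below a non-zero shell every shell is non-zero somewhere.

This is the rigorous form of the refuter's «lowest active shell is unfed» analysis (stmt-21808 batch 14,
stmt-23197 note of 2026-08-27) used to dismiss finitely supported constructions.
-/

noncomputable section

set_option linter.dupNamespace false

namespace Summit.NavierStokesRegularity.NavierStokesRegularity.Theorems

namespace WakeRatchetUnfed

open Filter Topology MeasureTheory Set intervalIntegral
open scoped RealInnerProductSpace
open Literature.Analysis.FluidPDE Literature.Analysis.FluidPDE.TaoCascade
open WakeRatchetFedSpike

variable {m : ℕ} {ε₀ νh : ℝ} {α : Fin m → Fin m → Fin m → ℤ × ℤ × ℤ → ℝ} {W : ℤ → ℝ → Em m}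

/-- **An unfed shell vanishes.**  On a cancelling table, if shell `k-1` of an admissible eternal
solution (any covariant viscosity `ν̂ ≥ 0`) is identically zero, so is shell `k`.
[cite: Tao2016AveragedNS, §4 Lemma 4.1 (4.8)–(4.10) with (4.3), self-similar variables of §6.4; cell vocabulary (`IsEternalVisc`)] -/
theorem eq_zero_of_unfed (hε : 0 < ε₀) (hc : IsCancellingCoeff α) (hW : IsEternalVisc ε₀ νh α W)
    (k : ℤ) (h0 : ∀ σ, W (k - 1) σ = 0) : ∀ σ, W k σ = 0 := by
  obtain ⟨M, hM⟩ := hW.action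
  have hS := table_sTable α hc
  have hΛpos : 0 < bigLam ε₀ := bigLam_pos (by linarith)
  have hκ : 0 ≤ fluxConst α * (bigLam ε₀)⁻¹ := mul_nonneg hS.CA_nonneg (inv_nonneg.2 hΛpos.le)
  -- the fence with zero source: `e^{b}‖W_k(b)‖ ≤ e^{κM} e^{a}‖W_k(a)‖` for `a ≤ b`
  have hfence : ∀ a b : ℝ, a ≤ b → Real.exp b * ‖W k b‖
      ≤ Real.exp (fluxConst α * (bigLam ε₀)⁻¹ * M) * (Real.exp a * ‖W k a‖) := by
    intro a b hab
    have h := fedSpike hε hc hW k hab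
    have hsrc : ∫ s in a..b, bigLam ε₀ * fluxConst α * (Real.exp s * ‖W (k - 1) s‖ ^ 2) = 0 := by
      simp only [h0, norm_zero]; simp
    rw [hsrc, add_zero] at h
    refine h.trans (mul_le_mul_of_nonneg_right ?_ (by positivity))
    exact Real.exp_le_exp.2 (mul_le_mul_of_nonneg_left
      (intervalIntegral_le_integral (hM (k + 1)).1 (fun _ => norm_nonneg _) hab |>.trans (hM (k + 1)).2) hκ)
  intro b
  by_contra hb
  have hb' : 0 < ‖W k b‖ := norm_pos_iff.2 hb
  set K : ℝ := Real.exp (fluxConst α * (bigLam ε₀)⁻¹ * M) with hK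
  have hKpos : 0 < K := Real.exp_pos _
  -- the forced lower bound `‖W_k(a)‖ ≥ (e^{b}‖W_k(b)‖/K) e^{-a}` on `a ≤ b`
  set c : ℝ := Real.exp b * ‖W k b‖ / K with hcdef
  have hcpos : 0 < c := div_pos (mul_pos (Real.exp_pos _) hb') hKpos
  have hlow : ∀ a : ℝ, a ≤ b → c * Real.exp (-a) ≤ ‖W k a‖ := by
    intro a hab
    have h := hfence a b hab
    have h1 : c ≤ Real.exp a * ‖W k a‖ := by
      rw [hcdef, div_le_iff₀ hKpos]; linarith
    rw [Real.exp_neg]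
    have hea : 0 < Real.exp a := Real.exp_pos a
    calc c * (Real.exp a)⁻¹ ≤ (Real.exp a * ‖W k a‖) * (Real.exp a)⁻¹ :=
          mul_le_mul_of_nonneg_right h1 (inv_nonneg.2 hea.le)
      _ = ‖W k a‖ := by field_simp
  -- but `‖W_k‖` is integrable, so it drops below `c e^{-b}` somewhere on `(-∞, b]`
  obtain ⟨a, hab, ha⟩ := exists_le_abs_lt (hM k).1 (mul_pos hcpos (Real.exp_pos (-b))) b
  rw [abs_of_nonneg (norm_nonneg _)] at ha
  have hmono : c * Real.exp (-b) ≤ c * Real.exp (-a) :=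
    mul_le_mul_of_nonneg_left (Real.exp_le_exp.2 (by linarith)) hcpos.le
  linarith [hlow a hab]

/-- **Admissible eternal solutions have support unbounded below.**  If an admissible eternal solution
of a cancelling table vanishes on every shell `n ≤ n₀`, it vanishes identically: no non-trivial
admissible solution lives on a half-lattice `{n > n₀}`.
[cite: Tao2016AveragedNS, §4 Lemma 4.1 (4.8)–(4.10) with (4.3), §6.4; cell vocabulary (`IsEternalVisc`)] -/
theorem eq_zero_of_vanishing_below (hε : 0 < ε₀) (hc : IsCancellingCoeff α)
    (hW : IsEternalVisc ε₀ νh α W) {n₀ : ℤ} (h0 : ∀ n : ℤ, n ≤ n₀ → ∀ σ, W n σ = 0) :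
    ∀ (n : ℤ) (σ : ℝ), W n σ = 0 := by
  have key : ∀ n : ℤ, n₀ ≤ n → ∀ σ, W n σ = 0 := by
    intro n hn
    induction n, hn using Int.leInduction with
    | base => exact h0 n₀ le_rfl
    | succ n hn ih =>
        have h := eq_zero_of_unfed hε hc hW (n + 1) (by simpa using ih)
        exact h
  intro n σ
  rcases le_or_gt n n₀ with h | h
  · exact h0 n h σ
  · exact key n h.le σ

/-- **Below a non-zero shell every shell is non-zero** (contrapositive of `eq_zero_of_unfed`, iterated).
[cite: Tao2016AveragedNS, §4, §6.4; cell vocabulary (`IsEternalVisc`)] -/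
theorem exists_ne_zero_below (hε : 0 < ε₀) (hc : IsCancellingCoeff α) (hW : IsEternalVisc ε₀ νh α W)
    {k : ℤ} (hk : ∃ σ, W k σ ≠ 0) : ∀ j : ℤ, j ≤ k → ∃ σ, W j σ ≠ 0 := by
  intro j hj
  by_contra hnone
  push Not at hnone
  -- all shells `≤ j` vanish: below `j` by downward induction is not needed — vanishing AT `j` propagates up
  have hup : ∀ n : ℤ, j ≤ n → ∀ σ, W n σ = 0 := by
    intro n hn
    induction n, hn using Int.leInduction with
    | base => exact hnone
    | succ n hn ih => exact eq_zero_of_unfed hε hc hW (n + 1) (by simpa using ih)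
  obtain ⟨σ, hσ⟩ := hk
  exact hσ (hup k hj σ)

end WakeRatchetUnfed

end Summit.NavierStokesRegularity.NavierStokesRegularity.Theorems
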